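import Summits.QuantumFields.YangMills.Theorems.CovariantDischargeTruncatedPotentialPairing
import Summits.QuantumFields.YangMills.Theorems.CovariantDischargeGreenPotentialL2
import Summits.QuantumFields.YangMills.Theorems.CovariantDischargeGreenPotentialShell
import HarnessLib

/-!
# Line «sandwich_discharge» on crux `HistoryTailL` (stmt-QuantumFields-19936), stub `stub_sandwichSweepGapCapped` (S′), brick B5 —
# (Z-e) FILE 4 «B5 ON ℤ³, ASSEMBLED»: the truncated Green potential of a mean-zero 2-form charge and its four rows (PAIRING, COST, ℓ¹ MASS, SUP)
# with ABSOLUTE constants — hypotheses = the data only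

Cell `ym3-torus` (YM ladder rung R3 = continuum SU(2) Yang–Mills on the three-torus — a RUNG, NOT the Clay problem: not d = 4, not infinite volume,
not a mass gap); width seat `ym3-torus-px8` gen 7; `--supports stmt-QuantumFields-19936` (helper).  THEOREMS ONLY (0 `def`, default heartbeats), `d = 3`.
The knit of px8 g6 ARCH-S′ §3 ∕ w8 g8 LOCATE-B5-Z3 (Z-e) on the `ℤ³` side: FILE 1 `…TruncatedPotentialPairing` (exact pairing identity + error rows) ⊕
FILE 2 `…GreenPotentialL2` (Poisson + `j`-uniform ℓ² row over ✓(Z-d)) ⊕ FILE 3 `…GreenPotentialShell` (shell ∕ bulk ∕ near mass over ✓(Z-c)) ⊕ ✓(Z-b)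
`exists_cutoff_box_two_box` ⊕ ✓(Z-c′) `exists_fdiff_latticeGreen_box_bounds`.

★★★ `exists_truncatedPotential` — THERE ARE ABSOLUTE CONSTANTS `A_S A_B A_B′ A_Q A_L A_L′ A_T ≥ 0` SUCH THAT: for every centre `p ∈ ℤ³`, radius `ℓ`, every
real 2-form `ω` on `ℤ³` vanishing off `box p ℓ`, antisymmetric, with every component of mean zero, and every `R ≥ max 12 (2ℓ + 4)`, there is a real 1-form
`a_R` on `ℤ³` (namely `χ_R·δ₂(G₀ ∗ ω)`, `χ_R` the standard cutoff of (Z-b)) with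
* (0) SUPPORT `a_R = 0` off `box p (2R)`;
* (P) PAIRING: for every 2-form `F` with `|F| ≤ θ` on `box p (2R+2)` (`θ ≥ 0`) and `|d₂F| ≤ η` on `box p (2R)` (alternating `d₂`, (Z-a)'s letter):
  `|Σ_{box p (2R+2)} Σ_{μν} d₁a_R·F − Σ_{box p (2R+2)} Σ_{μν} ω·F| ≤ θ·A_S·M₁∕R + (η∕3)·(A_B + A_B′·(2R + ℓ))·M₀`;
* (Q) COST: for every finite `B`, `Σ_B Σ_{μν} (d₁a_R)² ≤ 328·W + A_Q·M₁²∕(R − 2)⁵` (`j`-UNIFORM main term; the shell term is `O(R⁻⁵)`);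
* (S) ℓ¹ MASS: `Σ_B Σ_ν |a_R| ≤ (A_L + A_L′·(2R + 1 + ℓ))·M₀`;   (T) SUP: `|a_R(x,ν)| ≤ A_T·M₀`;
where `M₀ := Σ_{μν} Σ_y |ω|`, `M₁ := Σ_{μν} Σ_y ‖y − p‖₁|ω|`, `W := Σ_{μν} Σ_y ω²` over `box p ℓ`.  For the dipole-matched pair of ARCH-S′ §3 (w8 ADDENDUM §B:
`M₀ ≍ L^{2j}`, `M₁ ≲ L^{2j+h}`, `W ≲ L^j`) this is B5 with every «≤» a kernel theorem; the transplant to the torus ball and B4 are FILE 5.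
HONEST SCOPE: assembly of landed∕signed finite-sum rows; NOTHING here proves the capped stub, `HistoryTailL`, or any summit statement; YM₃ on T³ is rung R3,
not Clay. [folklore]
-/

noncomputable section

open scoped BigOperators
open Finset

namespace Summit.QuantumFields.YangMills.Theorems.CovariantDischargeTruncatedPotentialZ3

open Literature.Probability.LatticeModels (latticeGreen)
open Literature.MathematicalPhysics.QuantumFieldTheory.Balaban1983to89.B4Eq19LatticeOperators
open Summit.QuantumFields.YangMills.Theorems.CovariantDischargeCutoffCommutator (exists_cutoff_box_two_box curl_comm_eq_zero_of_mem_box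
  curl_comm_eq_zero_of_not_mem_box abs_curl_comm_le)
open Summit.QuantumFields.YangMills.Theorems.CovariantDischargeTruncatedPotentialPairing (abs_sum_curl_truncated_mul_sub_le sq_curl_truncated_le
  sum_le_sum_shell_of_nonneg abs_truncated_le truncated_eq_zero_off sum_abs_truncated_le)
open Summit.QuantumFields.YangMills.Theorems.CovariantDischargeGreenPotentialL2 (poisson_of_halfGreen_conv sum_sq_curl_potential_le)
open Summit.QuantumFields.YangMills.Theorems.CovariantDischargeGreenPotentialShell (abs_potential_le_far shell_le_of_twelve_le bulk_mass_le near_mass_le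
  mass_le_total)
open Summit.QuantumFields.YangMills.Theorems.CovariantDischargeFreeGreenKernelBoxBounds (exists_fdiff_latticeGreen_box_bounds)

/-! ## §1 Two small rows: the sup of the first-difference kernel, and the sup of the potential -/

/-- `box 0 0 = {0}`: a nonzero lattice point lies outside `box 0 0`. [folklore] -/
theorem not_mem_box_zero_zero {w : Zd 3} (hw : w ≠ 0) : w ∉ box (0 : Zd 3) ((1 : ℕ) - 1 : ℤ) := by
  intro h
  apply hw
  rw [mem_box] at h
  funext i
  have := h i
  simp only [Pi.zero_apply, sub_zero, Nat.cast_one, sub_self, abs_nonpos_iff] at this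
  simpa using this

/-- **SUP OF THE KERNEL**: under (H1), `|K_e(w)| ≤ C₁ + Σ_e|K_e 0|` for every `w`. [folklore] -/
theorem abs_kernel_le {C₁ : ℝ} (hC₁ : 0 ≤ C₁)
    (hK1 : ∀ (e : Fin 3) (w : Zd 3) (n : ℕ), 1 ≤ n → w ∉ box (0 : Zd 3) ((n : ℤ) - 1) →
      |latticeGreen (w + unitVec e) - latticeGreen w| ≤ C₁ / (n : ℝ) ^ 2) (e : Fin 3) (w : Zd 3) :
    |latticeGreen (w + unitVec e) - latticeGreen w| ≤ C₁ + ∑ e' : Fin 3, |latticeGreen (unitVec e') - latticeGreen (0 : Zd 3)| := by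
  have hK₀ : 0 ≤ ∑ e' : Fin 3, |latticeGreen (unitVec e') - latticeGreen (0 : Zd 3)| := Finset.sum_nonneg fun _ _ => abs_nonneg _
  by_cases hw : w = 0
  · subst hw
    rw [zero_add]
    have := Finset.single_le_sum (f := fun e' : Fin 3 => |latticeGreen (unitVec e') - latticeGreen (0 : Zd 3)|) (fun _ _ => abs_nonneg _)
      (Finset.mem_univ e)
    linarith
  · have h := hK1 e w 1 le_rfl (by exact_mod_cast not_mem_box_zero_zero hw)
    simp only [Nat.cast_one, one_pow, div_one] at h
    linarith

/-- **SUP OF THE POTENTIAL** (crude, no decay): `|a(x,ν)| ≤ ½(C₁ + Σ_e|K_e 0|)·M₀`. [folklore] -/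
theorem abs_potential_le {C₁ : ℝ} (hC₁ : 0 ≤ C₁)
    (hK1 : ∀ (e : Fin 3) (w : Zd 3) (n : ℕ), 1 ≤ n → w ∉ box (0 : Zd 3) ((n : ℤ) - 1) →
      |latticeGreen (w + unitVec e) - latticeGreen w| ≤ C₁ / (n : ℝ) ^ 2)
    (ω β : Zd 3 → Fin 3 → Fin 3 → ℝ) (a : Zd 3 → Fin 3 → ℝ) (p : Zd 3) (ℓ : ℕ)
    (hβ : ∀ x μ ν, β x μ ν = ∑ y ∈ box p ℓ, latticeGreen (x - y) / 2 * ω y μ ν)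
    (ha : ∀ x ν, a x ν = ∑ μ, (β (x - unitVec μ) μ ν - β x μ ν)) (x : Zd 3) (ν : Fin 3) :
    |a x ν| ≤ (1 / 2) * (C₁ + ∑ e' : Fin 3, |latticeGreen (unitVec e') - latticeGreen (0 : Zd 3)|) * ∑ μ, ∑ ν, ∑ y ∈ box p ℓ, |ω y μ ν| := by
  obtain ⟨K, hK⟩ : ∃ K : ℝ, K = C₁ + ∑ e' : Fin 3, |latticeGreen (unitVec e') - latticeGreen (0 : Zd 3)| := ⟨_, rfl⟩
  have hK0 : 0 ≤ K := by rw [hK]; exact add_nonneg hC₁ (Finset.sum_nonneg fun _ _ => abs_nonneg _)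
  rw [← hK, Summit.QuantumFields.YangMills.Theorems.CovariantDischargeGreenPotentialShell.potential_eq_conv ω β a p ℓ hβ ha x ν, abs_mul, abs_neg,
    abs_of_pos (by norm_num : (0 : ℝ) < 1 / 2), mul_assoc]
  refine mul_le_mul_of_nonneg_left ?_ (by norm_num)
  -- `|Σ_μ Σ_y K·ω| ≤ Σ_μ Σ_y K∞|ω| ≤ K∞·M₀`
  have h1 : |∑ μ, ∑ y ∈ box p ℓ, (latticeGreen (x - unitVec μ - y + unitVec μ) - latticeGreen (x - unitVec μ - y)) * ω y μ ν|
      ≤ ∑ μ, ∑ y ∈ box p ℓ, K * |ω y μ ν| := by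
    refine (Finset.abs_sum_le_sum_abs _ _).trans (Finset.sum_le_sum fun μ _ => ?_)
    refine (Finset.abs_sum_le_sum_abs _ _).trans (Finset.sum_le_sum fun y _ => ?_)
    rw [abs_mul]
    refine mul_le_mul_of_nonneg_right ?_ (abs_nonneg _)
    rw [hK]; exact abs_kernel_le hC₁ hK1 μ (x - unitVec μ - y)
  refine h1.trans ?_
  simp only [← Finset.mul_sum]
  refine mul_le_mul_of_nonneg_left ?_ hK0
  calc ∑ μ, ∑ y ∈ box p ℓ, |ω y μ ν| ≤ ∑ μ, ∑ ν', ∑ y ∈ box p ℓ, |ω y μ ν'| :=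
        Finset.sum_le_sum fun μ _ => Finset.single_le_sum (f := fun ν' => ∑ y ∈ box p ℓ, |ω y μ ν'|)
          (fun _ _ => Finset.sum_nonneg fun _ _ => abs_nonneg _) (Finset.mem_univ ν)
    _ = _ := rfl

/-! ## §2 The shell term of the cost row -/

/-- **THE SQUARED COMMUTATOR ON THE SHELL**: with the standard cutoff (`1` on `box p R`, `0` off `box p (2R)`, `1∕R`-Lipschitz) and the far-field bound
`|a| ≤ P` off `box p (R−2)`, for every finite `B`: `Σ_B Σ_{μν} E₁² ≤ #box p (2R+1)·9·(2P∕R)²`. [folklore] -/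
theorem sum_sq_commOne_le (a : Zd 3 → Fin 3 → ℝ) (χ : Zd 3 → ℝ) (p : Zd 3) (R : ℕ) {P : ℝ}
    (hχ1 : ∀ x ∈ box p (R : ℤ), χ x = 1) (hχ0 : ∀ x, x ∉ box p (2 * (R : ℤ)) → χ x = 0)
    (hχp : ∀ x μ, |χ (x + unitVec μ) - χ x| ≤ 1 / R) (hfar : ∀ x, x ∉ box p ((R : ℤ) - 2) → ∀ ν, |a x ν| ≤ P) (B : Finset (Zd 3)) :
    ∑ y ∈ B, ∑ μ, ∑ ν, ((χ (y + unitVec μ) - χ y) * a (y + unitVec μ) ν - (χ (y + unitVec ν) - χ y) * a (y + unitVec ν) μ) ^ 2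
      ≤ ((box p (2 * (R : ℤ) + 1)).card : ℝ) * (9 * (2 * P / R) ^ 2) := by
  have hR0 : (0 : ℝ) ≤ 1 / R := by positivity
  -- the summand vanishes on the plateau and outside, and is ≤ 9(2P/R)² on the shell
  have hg0 : ∀ y, 0 ≤ ∑ μ, ∑ ν, ((χ (y + unitVec μ) - χ y) * a (y + unitVec μ) ν - (χ (y + unitVec ν) - χ y) * a (y + unitVec ν) μ) ^ 2 :=
    fun y => Finset.sum_nonneg fun _ _ => Finset.sum_nonneg fun _ _ => sq_nonneg _
  have hin : ∀ y ∈ box p ((R : ℤ) - 1),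
      ∑ μ, ∑ ν, ((χ (y + unitVec μ) - χ y) * a (y + unitVec μ) ν - (χ (y + unitVec ν) - χ y) * a (y + unitVec ν) μ) ^ 2 = 0 := by
    intro y hy; simp only [curl_comm_eq_zero_of_mem_box hχ1 hy a, zero_pow two_ne_zero, Finset.sum_const_zero]
  have hout : ∀ y, y ∉ box p (2 * (R : ℤ) + 1) →
      ∑ μ, ∑ ν, ((χ (y + unitVec μ) - χ y) * a (y + unitVec μ) ν - (χ (y + unitVec ν) - χ y) * a (y + unitVec ν) μ) ^ 2 = 0 := by
    intro y hy; simp only [curl_comm_eq_zero_of_not_mem_box hχ0 hy a, zero_pow two_ne_zero, Finset.sum_const_zero]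
  refine (sum_le_sum_shell_of_nonneg _ p ((R : ℤ) - 1) (2 * (R : ℤ) + 1) hg0 hin hout B).trans ?_
  have hsite : ∀ y ∈ box p (2 * (R : ℤ) + 1) \ box p ((R : ℤ) - 1),
      ∑ μ, ∑ ν, ((χ (y + unitVec μ) - χ y) * a (y + unitVec μ) ν - (χ (y + unitVec ν) - χ y) * a (y + unitVec ν) μ) ^ 2 ≤ 9 * (2 * P / R) ^ 2 := by
    intro y hy
    have hy' : y ∉ box p ((R : ℤ) - 1) := (Finset.mem_sdiff.1 hy).2
    have hyy : y ∉ box p ((R : ℤ) - 2 + 1) := by rwa [show (R : ℤ) - 2 + 1 = (R : ℤ) - 1 by ring]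
    have hfar' : ∀ μ ν, |a (y + unitVec μ) ν| ≤ P := fun μ ν => hfar _ (add_unitVec_not_mem_box hyy μ) ν
    have hE : ∀ μ ν, ((χ (y + unitVec μ) - χ y) * a (y + unitVec μ) ν - (χ (y + unitVec ν) - χ y) * a (y + unitVec ν) μ) ^ 2 ≤ (2 * P / R) ^ 2 := by
      intro μ ν
      have h1 := abs_curl_comm_le hχp a y μ ν
      have h2 : 1 / (R : ℝ) * (|a (y + unitVec μ) ν| + |a (y + unitVec ν) μ|) ≤ 2 * P / R := by
        rw [show 2 * P / (R : ℝ) = 1 / R * (P + P) by ring]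
        exact mul_le_mul_of_nonneg_left (add_le_add (hfar' μ ν) (hfar' ν μ)) hR0
      rw [← sq_abs]
      exact pow_le_pow_left₀ (abs_nonneg _) (h1.trans h2) 2
    calc ∑ μ, ∑ ν, ((χ (y + unitVec μ) - χ y) * a (y + unitVec μ) ν - (χ (y + unitVec ν) - χ y) * a (y + unitVec ν) μ) ^ 2
        ≤ ∑ _μ : Fin 3, ∑ _ν : Fin 3, (2 * P / R) ^ 2 := Finset.sum_le_sum fun μ _ => Finset.sum_le_sum fun ν _ => hE μ ν
      _ = 9 * (2 * P / R) ^ 2 := by simp only [Finset.sum_const, Finset.card_univ, Fintype.card_fin, nsmul_eq_mul]; ring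
  calc ∑ y ∈ box p (2 * (R : ℤ) + 1) \ box p ((R : ℤ) - 1), ∑ μ, ∑ ν,
        ((χ (y + unitVec μ) - χ y) * a (y + unitVec μ) ν - (χ (y + unitVec ν) - χ y) * a (y + unitVec ν) μ) ^ 2
      ≤ ∑ _y ∈ box p (2 * (R : ℤ) + 1) \ box p ((R : ℤ) - 1), 9 * (2 * P / R) ^ 2 := Finset.sum_le_sum hsite
    _ = (((box p (2 * (R : ℤ) + 1) \ box p ((R : ℤ) - 1)).card : ℕ) : ℝ) * (9 * (2 * P / R) ^ 2) := by rw [Finset.sum_const, nsmul_eq_mul]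
    _ ≤ ((box p (2 * (R : ℤ) + 1)).card : ℝ) * (9 * (2 * P / R) ^ 2) := by
        refine mul_le_mul_of_nonneg_right ?_ (by positivity)
        exact_mod_cast Finset.card_le_card Finset.sdiff_subset

/-- The shell term priced: with `P = 12C₂M₁∕(R−2)³` and `R ≥ 12`, `#box p (2R+1)·9·(2P∕R)² ≤ 700000·C₂²·M₁²∕(R−2)⁵`. [folklore] -/
theorem shell_cost_le (C₂ M₁ : ℝ) (p : Zd 3) (R : ℕ) (hR12 : 12 ≤ R) :
    ((box p (2 * (R : ℤ) + 1)).card : ℝ) * (9 * (2 * (12 * C₂ / ((R - 2 : ℕ) : ℝ) ^ 3 * M₁) / R) ^ 2)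
      ≤ 700000 * C₂ ^ 2 * M₁ ^ 2 / ((R : ℝ) - 2) ^ 5 := by
  have hcard : ((box p (2 * (R : ℤ) + 1)).card : ℝ) = (4 * (R : ℝ) + 3) ^ 3 := by
    rw [card_box p (by positivity)]; push_cast; ring
  have hR2 : ((R - 2 : ℕ) : ℝ) = (R : ℝ) - 2 := by rw [Nat.cast_sub (by omega)]; push_cast; ring
  rw [hcard, hR2]
  have hR' : (12 : ℝ) ≤ R := by exact_mod_cast hR12
  have ht : (0 : ℝ) < (R : ℝ) - 2 := by linarith
  have hRpos : (0 : ℝ) < R := by linarith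
  -- `(4R+3)³·9·4·144 / (R²(R−2)⁶) ≤ 700000 / (R−2)⁵`, using `4R+3 ≤ 5.1(R−2)` and `R ≥ R−2`
  have h51 : 4 * (R : ℝ) + 3 ≤ (51 / 10) * ((R : ℝ) - 2) := by linarith
  have hlhs : (4 * (R : ℝ) + 3) ^ 3 * (9 * (2 * (12 * C₂ / ((R : ℝ) - 2) ^ 3 * M₁) / R) ^ 2)
      = ((4 * (R : ℝ) + 3) ^ 3 / (R : ℝ) ^ 2) * (5184 * C₂ ^ 2 * M₁ ^ 2 / ((R : ℝ) - 2) ^ 6) := by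
    field_simp
    ring
  rw [hlhs]
  have hA : (4 * (R : ℝ) + 3) ^ 3 / (R : ℝ) ^ 2 ≤ (51 / 10) ^ 3 * ((R : ℝ) - 2) := by
    rw [div_le_iff₀ (by positivity)]
    have h0 : (0 : ℝ) ≤ 4 * (R : ℝ) + 3 := by positivity
    calc (4 * (R : ℝ) + 3) ^ 3 ≤ ((51 / 10) * ((R : ℝ) - 2)) ^ 3 := pow_le_pow_left₀ h0 h51 3
      _ = (51 / 10) ^ 3 * ((R : ℝ) - 2) * (((R : ℝ) - 2) * ((R : ℝ) - 2)) := by ring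
      _ ≤ (51 / 10) ^ 3 * ((R : ℝ) - 2) * ((R : ℝ) * (R : ℝ)) := by
          refine mul_le_mul_of_nonneg_left ?_ (by positivity)
          exact mul_le_mul (by linarith) (by linarith) ht.le hRpos.le
      _ = (51 / 10) ^ 3 * ((R : ℝ) - 2) * (R : ℝ) ^ 2 := by ring
  calc (4 * (R : ℝ) + 3) ^ 3 / (R : ℝ) ^ 2 * (5184 * C₂ ^ 2 * M₁ ^ 2 / ((R : ℝ) - 2) ^ 6)
      ≤ ((51 / 10) ^ 3 * ((R : ℝ) - 2)) * (5184 * C₂ ^ 2 * M₁ ^ 2 / ((R : ℝ) - 2) ^ 6) :=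
        mul_le_mul_of_nonneg_right hA (by positivity)
    _ = ((51 / 10) ^ 3 * 5184) * (C₂ ^ 2 * M₁ ^ 2 / ((R : ℝ) - 2) ^ 5) := by field_simp
    _ ≤ 700000 * (C₂ ^ 2 * M₁ ^ 2 / ((R : ℝ) - 2) ^ 5) := mul_le_mul_of_nonneg_right (by norm_num) (by positivity)
    _ = 700000 * C₂ ^ 2 * M₁ ^ 2 / ((R : ℝ) - 2) ^ 5 := by ring

/-! ## §3 B5 on `ℤ³`, assembled -/

/-- ★★★ **B5 ON `ℤ³`** — see the module docstring: absolute constants, hypotheses = the data (`ω` on `box p ℓ`, antisymmetric, componentwise mean zero;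
`R ≥ max 12 (2ℓ+4)`), and the four rows (P)(Q)(S)(T) of the truncated Green potential `a_R = χ_R·δ₂(G₀ ∗ ω)`. [folklore] -/
theorem exists_truncatedPotential : ∃ A_S A_B A_B' A_Q A_L A_L' A_T : ℝ,
    0 ≤ A_S ∧ 0 ≤ A_B ∧ 0 ≤ A_B' ∧ 0 ≤ A_Q ∧ 0 ≤ A_L ∧ 0 ≤ A_L' ∧ 0 ≤ A_T ∧
    ∀ (p : Zd 3) (ℓ R : ℕ) (ω : Zd 3 → Fin 3 → Fin 3 → ℝ),
      (∀ x, x ∉ box p (ℓ : ℤ) → ∀ μ ν, ω x μ ν = 0) → (∀ x μ ν, ω x ν μ = -ω x μ ν) → (∀ μ ν, ∑ y ∈ box p (ℓ : ℤ), ω y μ ν = 0) →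
      2 * ℓ + 4 ≤ R → 12 ≤ R →
      ∃ aR : Zd 3 → Fin 3 → ℝ,
        (∀ x, x ∉ box p (2 * (R : ℤ)) → ∀ ν, aR x ν = 0) ∧
        (∀ (F : Zd 3 → Fin 3 → Fin 3 → ℝ) (dF : Zd 3 → Fin 3 → Fin 3 → Fin 3 → ℝ),
          (∀ x κ μ ν, dF x κ μ ν = (F (x + unitVec κ) μ ν - F x μ ν) - (F (x + unitVec μ) κ ν - F x κ ν) + (F (x + unitVec ν) κ μ - F x κ μ)) →
          ∀ (θ η : ℝ), 0 ≤ θ → (∀ y ∈ box p (2 * (R : ℤ) + 2), ∀ μ ν, |F y μ ν| ≤ θ) →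
            (∀ y ∈ box p (2 * (R : ℤ)), ∀ κ μ ν, |dF y κ μ ν| ≤ η) →
            |(∑ y ∈ box p (2 * (R : ℤ) + 2), ∑ μ, ∑ ν, ((aR (y + unitVec μ) ν - aR y ν) - (aR (y + unitVec ν) μ - aR y μ)) * F y μ ν)
                - ∑ y ∈ box p (2 * (R : ℤ) + 2), ∑ μ, ∑ ν, ω y μ ν * F y μ ν|
              ≤ θ * (A_S * (∑ μ, ∑ ν, ∑ y ∈ box p (ℓ : ℤ), (∑ i, |((y i - p i : ℤ) : ℝ)|) * |ω y μ ν|) / R)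
                + η / 3 * ((A_B + A_B' * (2 * (R : ℝ) + ℓ)) * ∑ μ, ∑ ν, ∑ y ∈ box p (ℓ : ℤ), |ω y μ ν|)) ∧
        (∀ B : Finset (Zd 3),
          ∑ y ∈ B, ∑ μ, ∑ ν, ((aR (y + unitVec μ) ν - aR y ν) - (aR (y + unitVec ν) μ - aR y μ)) ^ 2
            ≤ 328 * (∑ μ, ∑ ν, ∑ y ∈ box p (ℓ : ℤ), ω y μ ν ^ 2)
              + A_Q * (∑ μ, ∑ ν, ∑ y ∈ box p (ℓ : ℤ), (∑ i, |((y i - p i : ℤ) : ℝ)|) * |ω y μ ν|) ^ 2 / ((R : ℝ) - 2) ^ 5) ∧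
        (∀ B : Finset (Zd 3), ∑ y ∈ B, ∑ ν, |aR y ν| ≤ (A_L + A_L' * (2 * (R : ℝ) + 1 + ℓ)) * ∑ μ, ∑ ν, ∑ y ∈ box p (ℓ : ℤ), |ω y μ ν|) ∧
        (∀ x ν, |aR x ν| ≤ A_T * ∑ μ, ∑ ν, ∑ y ∈ box p (ℓ : ℤ), |ω y μ ν|) := by
  obtain ⟨C₁, C₂, hC₁, hC₂, hK⟩ := exists_fdiff_latticeGreen_box_bounds
  obtain ⟨K₀, hK₀⟩ : ∃ K : ℝ, K = ∑ e : Fin 3, |latticeGreen (unitVec e) - latticeGreen (0 : Zd 3)| := ⟨_, rfl⟩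
  have hK₀0 : 0 ≤ K₀ := by rw [hK₀]; exact Finset.sum_nonneg fun _ _ => abs_nonneg _
  refine ⟨72000 * C₂, (81 / 2) * K₀, (81 / 2) * (26 * C₁), 2 * (700000 * C₂ ^ 2), (9 / 2) * K₀, (9 / 2) * (26 * C₁), (1 / 2) * (C₁ + K₀),
    by positivity, by positivity, by positivity, by positivity, by positivity, by positivity, by positivity, ?_⟩
  intro p ℓ R ω hω0 hωanti hω1 hR hR12
  have hR1 : 1 ≤ R := by omega
  obtain ⟨χ, hχ01, hχ1, hχ0, hχp, hχm⟩ := exists_cutoff_box_two_box p hR1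
  -- the objects, as closed forms
  obtain ⟨β, hβ⟩ : ∃ β : Zd 3 → Fin 3 → Fin 3 → ℝ, ∀ x μ ν, β x μ ν = ∑ y ∈ box p (ℓ : ℤ), latticeGreen (x - y) / 2 * ω y μ ν :=
    ⟨fun x μ ν => ∑ y ∈ box p (ℓ : ℤ), latticeGreen (x - y) / 2 * ω y μ ν, fun _ _ _ => rfl⟩
  obtain ⟨a, ha⟩ : ∃ a : Zd 3 → Fin 3 → ℝ, ∀ x ν, a x ν = ∑ μ, (β (x - unitVec μ) μ ν - β x μ ν) :=
    ⟨fun x ν => ∑ μ, (β (x - unitVec μ) μ ν - β x μ ν), fun _ _ => rfl⟩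
  obtain ⟨γ, hγ⟩ : ∃ γ : Zd 3 → Fin 3 → Fin 3 → Fin 3 → ℝ, ∀ x κ μ ν,
      γ x κ μ ν = (β (x + unitVec κ) μ ν - β x μ ν) - (β (x + unitVec μ) κ ν - β x κ ν) + (β (x + unitVec ν) κ μ - β x κ μ) :=
    ⟨fun x κ μ ν => (β (x + unitVec κ) μ ν - β x μ ν) - (β (x + unitVec μ) κ ν - β x κ ν) + (β (x + unitVec ν) κ μ - β x κ μ), fun _ _ _ _ => rfl⟩
  obtain ⟨aR, haR⟩ : ∃ aR : Zd 3 → Fin 3 → ℝ, ∀ x ν, aR x ν = χ x * a x ν := ⟨fun x ν => χ x * a x ν, fun _ _ => rfl⟩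
  obtain ⟨daR, hdaR⟩ : ∃ daR : Zd 3 → Fin 3 → Fin 3 → ℝ, ∀ x μ ν, daR x μ ν = (aR (x + unitVec μ) ν - aR x ν) - (aR (x + unitVec ν) μ - aR x μ) :=
    ⟨fun x μ ν => (aR (x + unitVec μ) ν - aR x ν) - (aR (x + unitVec ν) μ - aR x μ), fun _ _ _ => rfl⟩
  -- masses
  obtain ⟨M₀, hM₀⟩ : ∃ M : ℝ, M = ∑ μ, ∑ ν, ∑ y ∈ box p (ℓ : ℤ), |ω y μ ν| := ⟨_, rfl⟩
  obtain ⟨M₁, hM₁⟩ : ∃ M : ℝ, M = ∑ μ, ∑ ν, ∑ y ∈ box p (ℓ : ℤ), (∑ i, |((y i - p i : ℤ) : ℝ)|) * |ω y μ ν| := ⟨_, rfl⟩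
  have hM₁0 : 0 ≤ M₁ := by
    rw [hM₁]; exact Finset.sum_nonneg fun _ _ => Finset.sum_nonneg fun _ _ => Finset.sum_nonneg fun _ _ => by positivity
  rw [← hM₀, ← hM₁]
  -- standing facts
  have hΔ := poisson_of_halfGreen_conv (d := 3) le_rfl ω β p (ℓ : ℤ) hω0 hβ
  have hβanti : ∀ x μ ν, β x ν μ = -β x μ ν := by
    intro x μ ν; rw [hβ, hβ, ← Finset.sum_neg_distrib]
    exact Finset.sum_congr rfl fun y _ => by rw [hωanti]; ring
  have hℓR : (ℓ : ℤ) ≤ (R : ℤ) := by omega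
  have hN : 2 * ℓ + 2 ≤ R - 2 := by omega
  refine ⟨aR, fun x hx ν => truncated_eq_zero_off a χ aR hχ0 haR x hx ν, ?_, ?_, ?_, ?_⟩
  · -- (P) the pairing row
    intro F dF hdF θ η hθ hF hdFle
    have hmain := abs_sum_curl_truncated_mul_sub_le ω β a γ χ aR daR p (ℓ : ℤ) (R : ℤ) (2 * (R : ℤ)) (2 * (R : ℤ) + 2) hω0 hℓR (by linarith)
      hΔ hβanti ha hγ hχ01 hχ1 hχ0 hχp hχm haR hdaR F dF hdF hθ hF hdFle
    have hshell := shell_le_of_twelve_le hC₂ (fun e => (hK e).2) ω β a γ p ℓ R hω1 hβ ha hγ hR hR12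
    have hbulk := bulk_mass_le hC₁ (fun e => (hK e).1) ω β γ p ℓ (2 * R) hβ hγ
    rw [← hM₁] at hshell
    rw [← hK₀, ← hM₀] at hbulk
    push_cast at hbulk
    have hη : 0 ≤ η := (abs_nonneg _).trans (hdFle p (self_mem_box p (by positivity)) 0 0 0)
    have hρ : (0 : ℝ) ≤ 1 / R := by positivity
    simp only [hdaR] at hmain
    refine hmain.trans (add_le_add ?_ ?_)
    · rw [show θ * (72000 * C₂ * M₁ / (R : ℝ)) = θ * (1 / R * (72000 * C₂ * M₁)) by ring]
      exact mul_le_mul_of_nonneg_left (mul_le_mul_of_nonneg_left hshell hρ) hθ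
    · exact mul_le_mul_of_nonneg_left (hbulk.trans (le_of_eq (by ring))) (by positivity)
  · -- (Q) the cost row
    intro B
    have hpt := fun y μ ν => sq_curl_truncated_le ω β a γ χ aR daR hΔ ha hγ hχ01 haR hdaR y μ ν
    have hmainQ := sum_sq_curl_potential_le (d := 3) le_rfl ω β γ p (ℓ : ℤ) hω0 hβ hγ B
    have hfar : ∀ x, x ∉ box p ((R : ℤ) - 2) → ∀ ν, |a x ν| ≤ 12 * C₂ / ((R - 2 : ℕ) : ℝ) ^ 3 * M₁ := by
      intro x hx ν
      rw [hM₁]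
      refine abs_potential_le_far hC₂ (fun e => (hK e).2) ω β a p ℓ hω1 hβ ha x ν (R - 2) hN ?_
      have : ((R - 2 : ℕ) : ℤ) = (R : ℤ) - 2 := by omega
      rwa [this]
    have hE := sum_sq_commOne_le a χ p R hχ1 hχ0 hχp hfar B
    have hEc := shell_cost_le C₂ M₁ p R hR12
    calc ∑ y ∈ B, ∑ μ, ∑ ν, ((aR (y + unitVec μ) ν - aR y ν) - (aR (y + unitVec ν) μ - aR y μ)) ^ 2
        ≤ ∑ y ∈ B, ∑ μ, ∑ ν, (2 * (ω y μ ν - ∑ κ, (γ (y - unitVec κ) κ μ ν - γ y κ μ ν)) ^ 2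
            + 2 * ((χ (y + unitVec μ) - χ y) * a (y + unitVec μ) ν - (χ (y + unitVec ν) - χ y) * a (y + unitVec ν) μ) ^ 2) := by
          refine Finset.sum_le_sum fun y _ => Finset.sum_le_sum fun μ _ => Finset.sum_le_sum fun ν _ => ?_
          have h := hpt y μ ν; rwa [hdaR] at h
      _ = 2 * (∑ y ∈ B, ∑ μ, ∑ ν, (ω y μ ν - ∑ κ, (γ (y - unitVec κ) κ μ ν - γ y κ μ ν)) ^ 2)
          + 2 * (∑ y ∈ B, ∑ μ, ∑ ν, ((χ (y + unitVec μ) - χ y) * a (y + unitVec μ) ν - (χ (y + unitVec ν) - χ y) * a (y + unitVec ν) μ) ^ 2) := by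
          simp only [Finset.sum_add_distrib, Finset.mul_sum]
      _ ≤ 2 * ((2 + 18 * (3 : ℝ) ^ 2) * ∑ y ∈ box p (ℓ : ℤ), ∑ μ, ∑ ν, ω y μ ν ^ 2)
          + 2 * (700000 * C₂ ^ 2 * M₁ ^ 2 / ((R : ℝ) - 2) ^ 5) := by
          have h3 : ((3 : ℕ) : ℝ) = 3 := by norm_num
          rw [h3] at hmainQ
          exact add_le_add (mul_le_mul_of_nonneg_left hmainQ (by norm_num)) (mul_le_mul_of_nonneg_left (hE.trans hEc) (by norm_num))
      _ = 328 * (∑ μ, ∑ ν, ∑ y ∈ box p (ℓ : ℤ), ω y μ ν ^ 2) + 2 * (700000 * C₂ ^ 2) * M₁ ^ 2 / ((R : ℝ) - 2) ^ 5 := by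
          have hc : ∑ y ∈ box p (ℓ : ℤ), ∑ μ, ∑ ν, ω y μ ν ^ 2 = ∑ μ, ∑ ν, ∑ y ∈ box p (ℓ : ℤ), ω y μ ν ^ 2 := by
            rw [Finset.sum_comm]; exact Finset.sum_congr rfl fun μ _ => Finset.sum_comm
          rw [hc]; ring
  · -- (S) the ℓ¹ mass row
    intro B
    have h1 := sum_abs_truncated_le a χ aR p (2 * (R : ℤ)) hχ01 hχ0 haR B
    have h2 := near_mass_le hC₁ (fun e => (hK e).1) ω β a p ℓ (2 * R) hβ ha
    rw [← hK₀, ← hM₀] at h2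
    push_cast at h2
    exact h1.trans (h2.trans (le_of_eq (by ring)))
  · -- (T) the sup row
    intro x ν
    have h1 := abs_truncated_le a χ aR hχ01 haR x ν
    have h2 := abs_potential_le hC₁ (fun e => (hK e).1) ω β a p ℓ hβ ha x ν
    rw [← hK₀, ← hM₀] at h2
    exact h1.trans h2

end Summit.QuantumFields.YangMills.Theorems.CovariantDischargeTruncatedPotentialZ3

end
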